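import Mathlib
import HarnessLib
import Literature.MathematicalPhysics.StatisticalMechanics.ComplexGradientStiffness
import Literature.Barriers.CriticalPhenomena.RigorousRGSmallParameterGaussianIntegration
import Summits.HubbardSuperconductivity.HubbardSuperconductivity.Theorems.ComplexGFFStiffnessDefs
import Summits.HubbardSuperconductivity.HubbardSuperconductivity.Theorems.ComplexGFFStiffnessHypACumulantPertZBasic

/-!
# Crux `HypACumulant`, line `gnv` — the perturbed partition function as a Gaussian expectation
# (`𝒵(𝒦) = Z_0 · E_{μ^{(0)}}[∏_x (1 + 𝒦(∇φ(x)))]`, ABKM19 (4.1)/(4.4)) over the tree's `P_C`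

Route `route-HubbardSuperconductivity-ComplexGFFStiffness`, crux item stmt-HubbardSuperconductivity-19154
(shared first rung with stmt-…-19155), research stub `stub_gnvOfFrd : TorusFRD 4 → GNV`.
The renormalisation-group analysis of the generalised non-vanishing statement `GNV`
(`…Theorems.ComplexGFF.GNV`) starts from the representation of the perturbed partition function
`pertZ n K = ∫ e^{−S_0(φ)} ∏_x (1 + K(∇φ(x))) dφ` as `Z_0` times the expectation of
`∏_x (1 + K(∇φ(x)))` under the normalised Gaussian measure `e^{−S_0} dφ / Z_0` — the measure
`μ^{(0)}` of Adams–Buchholz–Kotecký–Müller (arXiv:1910.13564, (4.1), (4.4): `𝒵_N(𝒦) = ∫ Σ_X ∏_{x∈X}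
𝒦(∇φ(x)) μ^{(0)}(dφ)`), on which the finite-range decomposition and the maps `R_k` act.  This file
provides that starting point and identifies `μ^{(0)}` with the tree's Gaussian measure
`LongRangePhi4.fieldGaussian Λ C 1` (`Literature/Barriers/CriticalPhenomena/RigorousRGSmallParameterGaussianIntegration.lean`:
`P_C` on field space with the convolution / progressive-integration calculus
`P_{C₁+C₂} = P_{C₁} ∗ P_{C₂}`), with covariance `C = A⁻¹` for the positive definite matrix
`A = −Δ_Λ + P_0` of the action `S_0(φ) = ½ (φ, A φ)` (lattice Laplacian of forward gradients plus
the rank-one zero-mode mass `P_0 = |Λ|⁻¹ 𝟙𝟙ᵀ` of `ComplexGradientGFF4.S`).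

## Contents (all proved; no definition, no named fact — the objects `gradMat`, `lapMat`,
## `zeroModeMat`, `massMat`, `gffMeasure`, `squeeze`, `squeezeEquiv` are in `ComplexGFFStiffnessDefs`)
* `gradMat_mulVec` (`∇_i φ = ∂_iφ`), `dotProduct_lapMat_mulVec` (`(φ, −Δφ) = Σ_{x,i} (∂_iφ(x))²`),
  `dotProduct_massMat_mulVec` (`(φ, Aφ) = 2 S_0(φ)`), `isHermitian_massMat`,
  `eq_zero_of_S_zero_eq_zero`, **`posDef_massMat`** (`A = −Δ_Λ + P_0 ≻ 0`);
* `isProbabilityMeasure_gffMeasure`; **`pertZ_eq_mul_integral_gffMeasure`**: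
  `pertZ n K = Z_0 · ∫ ∏_x (1 + K(∇φ(x))) d(gffMeasure n)` with `Z_0 = ∫ e^{−S_0} = pertZ n 0 > 0`
  (`pertZ_zero_eq_integral_exp`, `integral_exp_neg_S_pos`);
* `measurePreserving_squeezeEquiv`, `compForm_massMat` (`q_A(φ̃) = 2 S_0(squeeze φ̃)`), and
  **`integral_gffMeasure_eq_fieldGaussian`**: `∫ F d(gffMeasure n) = ∫ F ∘ squeeze dP_{A⁻¹}` for
  every integrand `F` — so `pertZ n K = Z_0 · E_{P_{A⁻¹}}[∏_x (1 + K(∇φ(x)))]`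
  (`pertZ_eq_mul_integral_fieldGaussian`), `P_C = LongRangePhi4.fieldGaussian Λ C 1`.

What is NOT here: the splitting `A⁻¹ = G + P_0` of the covariance into the mean-zero Green's
function and the zero mode, and the finite-range decomposition of `G` (`stub_frd`).

## References
* S. Adams, S. Buchholz, R. Kotecký, S. Müller, arXiv:1910.13564, Ch. 4, (4.1)–(4.4) (the
  partition function as a Gaussian integral of the polymer expansion of `∏(1+𝒦)`) and Ch. 6.1
  (the Gaussian measures `μ^{(q)}`, `μ_k`) [AdamsBuchholzKoteckyMuller2019].
-/

noncomputable section

-- `Summit.<Summit>.<Problem>`: single-conjunct summit, the duplicate component is mandated (D-0017).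
set_option linter.dupNamespace false

namespace Summit.HubbardSuperconductivity.HubbardSuperconductivity.Theorems.ComplexGFF

open scoped BigOperators ComplexConjugate Matrix
open MeasureTheory
open Literature.MathematicalPhysics.StatisticalMechanics.ComplexGradientGFF4 (Z D S Z_zero_zero_pos)
open Literature.Barriers.CriticalPhenomena.LongRangePhi4 (fieldGaussian compForm
  fieldGaussian_inv_eq_tilted integrable_exp_neg_compForm)

variable {n : ℕ} [NeZero n]

/-! ### §1 The action as a quadratic form: `S_0(φ) = ½ (φ, (−Δ + P_0) φ)` -/

/-- `∇_i φ = ∂_iφ` (`ComplexGradientGFF4.D`). -/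
theorem gradMat_mulVec (i : Fin 4) (φ : (Fin 4 → ZMod n) → ℝ) :
    gradMat n i *ᵥ φ = fun s => D φ i s := by
  funext s
  simp only [Matrix.mulVec, dotProduct, gradMat, sub_mul, ite_mul, one_mul, zero_mul,
    Finset.sum_sub_distrib, Finset.sum_ite_eq', Finset.mem_univ, if_true]
  rfl

/-- `(φ, −Δ_Λ φ) = Σ_x Σ_i (∂_iφ(x))²` (the Dirichlet form). -/
theorem dotProduct_lapMat_mulVec (φ : (Fin 4 → ZMod n) → ℝ) :
    φ ⬝ᵥ (lapMat n *ᵥ φ) = ∑ s : Fin 4 → ZMod n, ∑ i : Fin 4, (D φ i s) ^ 2 := by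
  rw [lapMat, Matrix.sum_mulVec, dotProduct_sum, Finset.sum_comm]
  refine Finset.sum_congr rfl fun i _ => ?_
  rw [← Matrix.mulVec_mulVec, Matrix.dotProduct_mulVec, Matrix.vecMul_transpose, gradMat_mulVec]
  simp only [dotProduct, sq]

/-- `(φ, P_0 φ) = (Σ_x φ(x))² / |Λ|`. -/
theorem dotProduct_zeroModeMat_mulVec (φ : (Fin 4 → ZMod n) → ℝ) :
    φ ⬝ᵥ (zeroModeMat n *ᵥ φ) =
      (∑ s : Fin 4 → ZMod n, φ s) ^ 2 / (Fintype.card (Fin 4 → ZMod n) : ℝ) := by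
  simp only [Matrix.mulVec, dotProduct, zeroModeMat, Matrix.of_apply, ← Finset.mul_sum,
    ← Finset.sum_mul]
  rw [sq, div_eq_mul_inv]
  ring

/-- **`(φ, A φ) = 2 S_0(φ)`**: the action of `ComplexGradientGFF4` is the quadratic form of
`A = −Δ_Λ + P_0`. -/
theorem dotProduct_massMat_mulVec (φ : (Fin 4 → ZMod n) → ℝ) :
    φ ⬝ᵥ (massMat n *ᵥ φ) = 2 * S 0 φ := by
  rw [massMat, Matrix.add_mulVec, dotProduct_add, dotProduct_lapMat_mulVec,
    dotProduct_zeroModeMat_mulVec, S_zero_eq]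
  have hc : (0 : ℝ) < (Fintype.card (Fin 4 → ZMod n) : ℝ) := by exact_mod_cast Fintype.card_pos
  field_simp

/-- `A` is symmetric. -/
theorem isHermitian_massMat : (massMat n).IsHermitian := by
  have h1 : (lapMat n).IsHermitian := by
    unfold Matrix.IsHermitian lapMat
    rw [Matrix.conjTranspose_sum]
    refine Finset.sum_congr rfl fun i _ => ?_
    rw [Matrix.conjTranspose_eq_transpose_of_trivial ((gradMat n i)ᵀ * gradMat n i),
      Matrix.transpose_mul, Matrix.transpose_transpose]
  have h2 : (zeroModeMat n).IsHermitian := by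
    refine Matrix.IsHermitian.ext fun i j => ?_
    simp [zeroModeMat]
  exact h1.add h2

/-- `S_0(φ) = 0` forces `φ = 0` (all gradients vanish ⇒ `φ` is constant on the connected torus;
the zero mode kills the constant) — re-derived here, the Literature version being private. -/
theorem eq_zero_of_S_zero_eq_zero {φ : (Fin 4 → ZMod n) → ℝ} (h : S 0 φ = 0) :
    φ = 0 := by
  have hcard : (0 : ℝ) < (Fintype.card (Fin 4 → ZMod n) : ℝ) := by exact_mod_cast Fintype.card_pos
  rw [S_zero_eq] at h
  set A : ℝ := ∑ s : Fin 4 → ZMod n, ∑ i : Fin 4, (D φ i s) ^ 2 with hA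
  set B : ℝ := ∑ s : Fin 4 → ZMod n, φ s with hB
  have hA0 : 0 ≤ A := by positivity
  have hB0 : 0 ≤ B ^ 2 / (2 * (Fintype.card (Fin 4 → ZMod n) : ℝ)) := by positivity
  have hA' : A = 0 := by linarith
  have hB2 : B ^ 2 / (2 * (Fintype.card (Fin 4 → ZMod n) : ℝ)) = 0 := by linarith
  have hB' : B = 0 := by
    have h3 : B ^ 2 = 0 := by
      rcases div_eq_zero_iff.mp hB2 with h3 | h3
      · exact h3
      · exfalso; linarith
    exact pow_eq_zero_iff two_ne_zero |>.mp h3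
  have hD : ∀ (i : Fin 4) (s : Fin 4 → ZMod n), D φ i s = 0 := by
    intro i s
    have hs : ∑ i' : Fin 4, (D φ i' s) ^ 2 = 0 :=
      (Finset.sum_eq_zero_iff_of_nonneg (fun s _ =>
        Finset.sum_nonneg (fun i _ => sq_nonneg (D φ i s)))).mp hA' s (Finset.mem_univ s)
    have := (Finset.sum_eq_zero_iff_of_nonneg (fun i _ => sq_nonneg (D φ i s))).mp hs i
      (Finset.mem_univ i)
    exact pow_eq_zero_iff two_ne_zero |>.mp this
  have hstep : ∀ (s : Fin 4 → ZMod n) (i : Fin 4), φ (s + Pi.single i 1) = φ s := fun s i => by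
    have := hD i s
    unfold D at this
    linarith
  have hshift : ∀ (i : Fin 4) (k : ℕ) (s : Fin 4 → ZMod n),
      φ (s + Pi.single i (k : ZMod n)) = φ s := by
    intro i k
    induction k with
    | zero => intro s; simp
    | succ k ih => intro s; rw [Nat.cast_succ, Pi.single_add, ← add_assoc, hstep, ih]
  have hconst : ∀ t : Fin 4 → ZMod n, φ t = φ 0 := by
    intro t
    have key : ∀ T : Finset (Fin 4), φ (∑ i ∈ T, Pi.single i (t i)) = φ 0 := by
      intro T
      refine Finset.induction_on T ?_ ?_
      · simp
      · intro j T hj ih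
        rw [Finset.sum_insert hj, add_comm, ← ZMod.natCast_zmod_val (t j), hshift, ih]
    have := key Finset.univ
    rwa [Finset.univ_sum_single] at this
  have hsum : B = (Fintype.card (Fin 4 → ZMod n) : ℝ) * φ 0 := by
    rw [hB, Finset.sum_congr rfl (fun s _ => hconst s), Finset.sum_const, Finset.card_univ,
      nsmul_eq_mul]
  have h0 : φ 0 = 0 := by
    have : (Fintype.card (Fin 4 → ZMod n) : ℝ) * φ 0 = 0 := by rw [← hsum]; exact hB'
    rcases mul_eq_zero.mp this with h | h
    · exact absurd h (ne_of_gt hcard)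
    · exact h
  funext s
  rw [Pi.zero_apply, hconst s, h0]

/-- **`A = −Δ_Λ + P_0` is positive definite** (so `e^{−S_0} dφ` is, after normalisation, the
Gaussian measure with covariance `A⁻¹`). -/
theorem posDef_massMat : (massMat n).PosDef := by
  refine Matrix.PosDef.of_dotProduct_mulVec_pos isHermitian_massMat fun φ hφ => ?_
  rw [star_trivial, dotProduct_massMat_mulVec]
  have h0 : 0 ≤ S 0 φ := S_zero_nonneg φ
  rcases h0.lt_or_eq with h | h
  · linarith
  · exact absurd (eq_zero_of_S_zero_eq_zero h.symm) hφ

/-! ### §2 The free measure `μ^{(0)} = e^{−S_0} dφ / Z_0` and `pertZ = Z_0 · E_{μ^{(0)}}[∏(1+K)]` -/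

/-- `μ^{(0)}` is a probability measure. -/
theorem isProbabilityMeasure_gffMeasure : IsProbabilityMeasure (gffMeasure n) :=
  isProbabilityMeasure_tilted (integrable_exp_neg_S n)

/-- `pertZ n 0 = Z_0 = ∫ e^{−S_0} dφ` as a complex number. -/
theorem pertZ_zero_eq_integral_exp :
    pertZ n (fun _ => 0) =
      ((∫ φ : (Fin 4 → ZMod n) → ℝ, Real.exp (-(S 0 φ)) : ℝ) : ℂ) := by
  unfold pertZ
  rw [← integral_complex_ofReal]
  refine integral_congr_ae (Filter.Eventually.of_forall (fun φ => ?_))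
  simp only [add_zero, Finset.prod_const_one, mul_one, Complex.ofReal_exp, Complex.ofReal_neg]

/-- `Z_0 = ∫ e^{−S_0} > 0`. -/
theorem integral_exp_neg_S_pos :
    0 < ∫ φ : (Fin 4 → ZMod n) → ℝ, Real.exp (-(S 0 φ)) := by
  have h := (pertZ_zero_pos n).1
  rwa [pertZ_zero_eq_integral_exp, Complex.ofReal_re] at h

/-- **`pertZ n K = Z_0 · E_{μ^{(0)}}[∏_x (1 + K(∇φ(x)))]`** (ABKM19 (4.1)/(4.4) before the polymer
expansion of the product): the perturbed partition function is the free partition function times a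
normalised Gaussian expectation.  Unconditional (both sides use the same Bochner conventions). -/
theorem pertZ_eq_mul_integral_gffMeasure (K : (Fin 4 → ℝ) → ℂ) :
    pertZ n K =
      ((∫ φ : (Fin 4 → ZMod n) → ℝ, Real.exp (-(S 0 φ)) : ℝ) : ℂ) *
        ∫ φ, (∏ x : Fin 4 → ZMod n, (1 + K (fun i => D φ i x))) ∂(gffMeasure n) := by
  set Z₀ : ℝ := ∫ φ : (Fin 4 → ZMod n) → ℝ, Real.exp (-(S 0 φ)) with hZ₀
  have hZ₀pos : 0 < Z₀ := integral_exp_neg_S_pos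
  rw [gffMeasure, integral_tilted, ← hZ₀]
  unfold pertZ
  rw [← integral_const_mul]
  refine integral_congr_ae (Filter.Eventually.of_forall (fun φ => ?_))
  simp only [Complex.real_smul, Complex.ofReal_div, Complex.ofReal_exp, Complex.ofReal_neg]
  have hZ : ((Z₀ : ℝ) : ℂ) ≠ 0 := Complex.ofReal_ne_zero.2 hZ₀pos.ne'
  field_simp

/-! ### §3 `μ^{(0)}` is the tree's Gaussian `P_{A⁻¹}` (one-component fields) -/

omit [NeZero n] in
/-- `squeezeEquiv` is `squeeze`. -/
theorem squeezeEquiv_apply (φ : (Fin 4 → ZMod n) → Fin 1 → ℝ) : squeezeEquiv n φ = squeeze φ := by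
  funext x
  rfl

/-- `squeeze` preserves Lebesgue measure. -/
theorem measurePreserving_squeezeEquiv :
    MeasurePreserving (squeezeEquiv n) (volume : Measure ((Fin 4 → ZMod n) → Fin 1 → ℝ))
      (volume : Measure ((Fin 4 → ZMod n) → ℝ)) :=
  volume_preserving_pi fun _ : Fin 4 → ZMod n => volume_preserving_funUnique (Fin 1) ℝ

/-- The quadratic form `q_A` of the tree's library on one-component fields is `2 S_0 ∘ squeeze`. -/
theorem compForm_massMat (φ : (Fin 4 → ZMod n) → Fin 1 → ℝ) :
    compForm (massMat n) φ = 2 * S 0 (squeeze φ) := by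
  rw [compForm, Fin.sum_univ_one, dotProduct_massMat_mulVec]
  rfl

/-- **`μ^{(0)}` is the Gaussian `P_{A⁻¹}`**: for every integrand `F` on scalar fields,
`∫ F d(gffMeasure n) = ∫ F(squeeze φ̃) dP_{A⁻¹}(φ̃)`, `P_C = LongRangePhi4.fieldGaussian Λ C 1`
(the tree's Gaussian measure with covariance `C` on field space, here `C = (−Δ_Λ + P_0)⁻¹`).
Both sides use the same Bochner conventions, so no integrability hypothesis is needed. -/
theorem integral_gffMeasure_eq_fieldGaussian {G : Type*} [NormedAddCommGroup G]
    [NormedSpace ℝ G] (F : ((Fin 4 → ZMod n) → ℝ) → G) :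
    ∫ φ, F φ ∂(gffMeasure n) =
      ∫ φ, F (squeeze φ) ∂(fieldGaussian (Fin 4 → ZMod n) (massMat n)⁻¹ 1) := by
  rw [gffMeasure, fieldGaussian_inv_eq_tilted posDef_massMat, integral_tilted, integral_tilted]
  -- normalisations agree: `∫ e^{−q_A/2} dφ̃ = ∫ e^{−S_0} dφ`
  have hZ : ∫ φ : (Fin 4 → ZMod n) → Fin 1 → ℝ, Real.exp (-(compForm (massMat n) φ) / 2) =
      ∫ φ : (Fin 4 → ZMod n) → ℝ, Real.exp (-(S 0 φ)) := by
    rw [← measurePreserving_squeezeEquiv.integral_comp']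
    refine integral_congr_ae (Filter.Eventually.of_forall (fun φ => ?_))
    simp only [compForm_massMat, squeezeEquiv_apply]
    congr 1; ring
  rw [hZ, ← measurePreserving_squeezeEquiv.integral_comp']
  refine integral_congr_ae (Filter.Eventually.of_forall (fun φ => ?_))
  simp only [compForm_massMat, squeezeEquiv_apply]
  congr 3; ring

/-- **`pertZ n K = Z_0 · E_{P_{A⁻¹}}[∏_x (1 + K(∇φ(x)))]`** — the starting representation of the
renormalisation-group analysis over the tree's Gaussian calculus (`fieldGaussian_add`,
`thetaConv_fieldGaussian_add`: progressive integration over any decomposition of `A⁻¹` into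
positive semidefinite pieces). -/
theorem pertZ_eq_mul_integral_fieldGaussian (K : (Fin 4 → ℝ) → ℂ) :
    pertZ n K =
      ((∫ φ : (Fin 4 → ZMod n) → ℝ, Real.exp (-(S 0 φ)) : ℝ) : ℂ) *
        ∫ φ, (∏ x : Fin 4 → ZMod n, (1 + K (fun i => D (squeeze φ) i x)))
          ∂(fieldGaussian (Fin 4 → ZMod n) (massMat n)⁻¹ 1) := by
  rw [pertZ_eq_mul_integral_gffMeasure, integral_gffMeasure_eq_fieldGaussian]

end Summit.HubbardSuperconductivity.HubbardSuperconductivity.Theorems.ComplexGFF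

end
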